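import Summits.Ventures.LatticeQCDFlow.Scaling.ReplicaExchangeGraphSwap
import Summits.Ventures.LatticeQCDFlow.Scaling.ReplicaExchangeDiffusive

/-!
HONEST FRAMING: exact (Metropolis-corrected) sampling algorithms for lattice gauge theory; figures
of merit are autocorrelation/cost numbers at stated couplings and volumes; no continuum-physics
claim.

# ReplicaExchangeGraphSwapDiffusive — THE SWAP TOPOLOGY AND THE HOT REPLICA'S THROUGHPUT BOUND THE BEST POSSIBLE
# ORDER: FOR ANY SWAP GRAPH WITH `m` EDGES, `h` OF THEM AT THE HOT REPLICA, SECTOR-PRESERVING MAPS AND SECTOR-FROZEN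
# COLD REPLICAS, `Gap ≤ t·h·d/(2·m·K·v)` (PATH `h/m = 1/K`, COMPLETE `2/(K+1)`, STAR `1`) AND, FOR EVERY TOPOLOGY,
# `Gap ≤ (1−t)·Q_0(A,Aᶜ)/((K+1)·K·v)` — ONE TUNNELLING REPLICA UPDATED ONE STEP IN `K+1` CAPS EVERY GRAPH AT ORDER
# `K²`; THE ADJACENT LADDER IS `K³` (lean-2 GEN-19, ours)

Venture-side (OURS).  Cell `lqcd-flow` (pub-lqcd), unit `pub-lqcd-lean-2-g19`, 2026-08-25.  Chapter G, sequel of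
`Scaling/ReplicaExchangeGraphSwap` (the sampler `ptGraphSampler t μ M e φ`: `m` edges `e_r = (i_r, l_r)` of levels,
maps `φ_r`, one edge tried per swap step) with the profile test functions of `Scaling/ReplicaExchangeDiffusive`.
Hypothesis on the maps: SECTOR-PRESERVING, `φ_r u ∈ A ↔ u ∈ A`.

## What is proved

* §1 `graphProfileCount_sub_swap` — an edge swap of levels `i ≠ l` changes `G_a(x) = Σ_k a_k f_A^{(μ_k)}(x_k)` by
  `(a_i − a_l)(1_{Aᶜ}(x_i) − 1_{Aᶜ}(x_l))`; **`ptGraph_dirichletForm_swap_le`** (ANY observable: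
  `𝓔_{GSw}(F) ≤ (2m)⁻¹Σ_rΣ_x π̃(x)(F(x) − F(x^{(r)}))²`); **`ptGraph_dirichletForm_swap_profileCount_le`**
  (`≤ (2m)⁻¹Σ_r (a_{i_r} − a_{l_r})²D_{i_r l_r}(A)`); `ptGraph_dirichletForm_split`.
* §2 **`ptGraph_spectralGap_le_profile`** — the profile ceiling for every graph:
  `Gap ≤ [t/(2m)·Σ_r (a_{i_r} − a_{l_r})²D_{i_r l_r}(A) + (1−t)/(K+1)·Σ_k a_k²Q_k(A,Aᶜ)]/Σ_k a_k²μ_k(A)μ_k(Aᶜ)`.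
* §3 the HOT-INDICATOR profile (`a_0 = 0`, `a_k = 1` for `k ≥ 1`): only edges touching level `0` have a gradient;
  **`ptGraphFrozen_spectralGap_le`** — sector-frozen cold replicas (`Q_k(A,Aᶜ) = 0`, `k ≥ 1`), `D ≤ d` on the
  hot-incident edges, `μ_k(A)μ_k(Aᶜ) ≥ v > 0` (`k ≥ 1`), `K ≥ 1`, `m ≥ 1` ⇒
  `Gap(ptGraphSampler t μ M e φ) ≤ t·h·d/(2·m·K·v)`, `h` = number of edges with an endpoint at level `0`;
  **`ptStarFrozen_spectralGap_le`** — the STAR (`e_r = (0, r+1)`, `m = h = K`): `Gap ≤ t·d/(2·K·v)`.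
* §4 the TOTAL sector count (`a ≡ 1`, swaps invisible on every graph): **`ptGraph_spectralGap_le_sectorCount`** —
  `Gap ≤ (1−t)Σ_kQ_k(A,Aᶜ)/((K+1)Σ_kμ_k(A)μ_k(Aᶜ))` for EVERY graph and sector-preserving maps;
  **`ptGraphFrozen_spectralGap_le_hot`** — sector-frozen cold replicas ⇒ `Gap ≤ (1−t)·Q_0(A,Aᶜ)/((K+1)·K·v)`:
  whatever the topology and the maps, ONE tunnelling replica that is updated one step in `K+1` and must serve `K`
  cold replicas caps the gap at order `K⁻²`.

Reading (no numerics implied): whatever the maps, a sector-frozen cold replica learns the sector only from the hot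
one.  Two throughputs bound the rate: per step the chosen edge touches the hot replica with probability `h/m`, shared
among `K` cold replicas (relaxation `≥ 2mKv/(thd)`: ladder `≥ 2K²v/(td)` and `≥ (2v/3td)K³` by the linear profile of
`Scaling/ReplicaExchangeDiffusive`; complete graph `≥ K(K+1)v/(td)`; star `≥ 2Kv/(td)`), AND the hot replica itself
produces a fresh sector label at rate `≤ (1−t)Q_0(A,Aᶜ)/(K+1)` per step while `K` replicas wait for one (relaxation
`≥ (K+1)Kv/((1−t)Q_0)` on EVERY graph).  So maps accepted between DISTANT levels can lower the order from `K³` to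
`K²`, not below; the second power of `K` is the price of one tunnelling replica under the uniform update schedule.
NOT CLAIMED: floors for general graphs; non-uniform update schedules; anything measured.  Literature grade (cell rule):
NEW TYPING; nothing cited as a fact; no new bib keys.
-/

noncomputable section

open Finset Function
open Literature.Probability.MarkovChains

namespace Summit.Ventures.LatticeQCDFlow.Scaling

variable {S : Type*} [Fintype S] [DecidableEq S] {K m : ℕ} {μ : Fin (K + 1) → S → ℝ}
  {M : Fin (K + 1) → S → S → ℝ} {t : ℝ} {e : Fin m → Fin (K + 1) × Fin (K + 1)} {φ : Fin m → Equiv.Perm S}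

/-! ## §1 The swap difference and the swap Dirichlet form on a graph -/

/-- **The swap difference formula on an edge:** for `i ≠ l` and a sector-preserving `φ`, the edge swap changes the
profile count by `(a_i − a_l)·(1_{Aᶜ}(x_i) − 1_{Aᶜ}(x_l))`. [ours] -/
theorem graphProfileCount_sub_swap (hμ1 : ∀ k, ∑ u, μ k u = 1) (a : Fin (K + 1) → ℝ) {A : Finset S}
    {ψ : Equiv.Perm S} (hψA : ∀ u, ψ u ∈ A ↔ u ∈ A) {i l : Fin (K + 1)} (hil : i ≠ l) (x : Fin (K + 1) → S) :
    (∑ k, a k * bottleneckTestFun (μ k) A (x k)) - ∑ k, a k * bottleneckTestFun (μ k) A (edgeFlowSwap ψ i l x k)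
      = (a i - a l) * ((if x i ∈ A then (0 : ℝ) else 1) - (if x l ∈ A then (0 : ℝ) else 1)) := by
  simp_rw [bottleneckTestFun_eq (hμ1 _)]
  rw [← Finset.sum_sub_distrib]
  have hterm : ∀ k, a k * ((if x k ∈ A then (0 : ℝ) else 1) - ∑ y ∈ Aᶜ, μ k y)
      - a k * ((if edgeFlowSwap ψ i l x k ∈ A then (0 : ℝ) else 1) - ∑ y ∈ Aᶜ, μ k y)
      = a k * ((if x k ∈ A then (0 : ℝ) else 1) - (if edgeFlowSwap ψ i l x k ∈ A then (0 : ℝ) else 1)) := by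
    intro k; ring
  simp_rw [hterm]
  rw [Fintype.sum_eq_add i l hil]
  · have hsymm : ψ.symm (x l) ∈ A ↔ x l ∈ A := by rw [← hψA (ψ.symm (x l)), Equiv.apply_symm_apply]
    rw [edgeFlowSwap_fst ψ hil, edgeFlowSwap_snd, if_congr hsymm rfl rfl, if_congr (hψA (x i)) rfl rfl]
    ring
  · intro k hk
    rw [edgeFlowSwap_of_ne ψ i l x hk.1 hk.2, sub_self, mul_zero]

/-- **The graph-swap Dirichlet form of ANY observable:**
`𝓔_π̃(ptGraphSwap μ e φ; F) ≤ (2m)⁻¹·Σ_r Σ_x π̃(x)(F(x) − F(x^{(r)}))²` (acceptance at most one; edges with distinct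
endpoints). [ours] -/
theorem ptGraph_dirichletForm_swap_le (hμ : ∀ k x, 0 < μ k x) (he : ∀ r, (e r).1 ≠ (e r).2)
    (F : (Fin (K + 1) → S) → ℝ) :
    dirichletForm (tensorFun μ) (ptGraphSwap μ e φ) F
      ≤ 1 / (2 * m) * ∑ r : Fin m, ∑ x : Fin (K + 1) → S,
          tensorFun μ x * (F x - F (edgeFlowSwap (φ r) (e r).1 (e r).2 x)) ^ 2 := by
  have hpt : ∀ x y : Fin (K + 1) → S, tensorFun μ x * ptGraphSwap μ e φ x y * (F x - F y) ^ 2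
      ≤ ptGraphProposal e φ x y * (tensorFun μ x * (F x - F y) ^ 2) := by
    intro x y
    by_cases hyx : y = x
    · rw [hyx, sub_self]; simp
    · rw [← mul_assoc]
      refine mul_le_mul_of_nonneg_right ?_ (sq_nonneg _)
      rw [tensorFun_mul_ptGraphSwap hμ he hyx]
      exact mul_le_mul_of_nonneg_left (min_le_left _ _) (ptGraphProposal_nonneg e φ x y)
  have hrow : ∀ (x : Fin (K + 1) → S) (c : (Fin (K + 1) → S) → ℝ),
      ∑ y, ptGraphProposal e φ x y * c y = ∑ r : Fin m, 1 / m * c (edgeFlowSwap (φ r) (e r).1 (e r).2 x) := by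
    intro x c
    unfold ptGraphProposal
    simp_rw [Finset.sum_mul]
    rw [Finset.sum_comm]
    refine sum_congr rfl fun r _ => ?_
    simp_rw [ite_mul, zero_mul]
    rw [Finset.sum_ite_eq' univ (edgeFlowSwap (φ r) (e r).1 (e r).2 x), if_pos (mem_univ _)]
  unfold dirichletForm
  calc 1 / 2 * ∑ x, ∑ y, tensorFun μ x * ptGraphSwap μ e φ x y * (F x - F y) ^ 2
      ≤ 1 / 2 * ∑ x, ∑ y, ptGraphProposal e φ x y * (tensorFun μ x * (F x - F y) ^ 2) :=
        mul_le_mul_of_nonneg_left (sum_le_sum fun x _ => sum_le_sum fun y _ => hpt x y) (by norm_num)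
    _ = 1 / 2 * ∑ x, ∑ r : Fin m, 1 / m * (tensorFun μ x * (F x - F (edgeFlowSwap (φ r) (e r).1 (e r).2 x)) ^ 2) := by
        congr 1
        exact sum_congr rfl fun x _ => hrow x (fun y => tensorFun μ x * (F x - F y) ^ 2)
    _ = 1 / (2 * m) * ∑ r : Fin m, ∑ x : Fin (K + 1) → S,
          tensorFun μ x * (F x - F (edgeFlowSwap (φ r) (e r).1 (e r).2 x)) ^ 2 := by
        rw [Finset.sum_comm]
        simp_rw [← Finset.mul_sum]
        rw [← mul_assoc]
        congr 1
        ring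

/-- **The graph-swap Dirichlet form of the profile count (sector-preserving maps):**
`𝓔_{GSw}(G_a) ≤ (2m)⁻¹·Σ_r (a_{i_r} − a_{l_r})²·D_{i_r l_r}(A)`. [ours] -/
theorem ptGraph_dirichletForm_swap_profileCount_le (hμ : ∀ k x, 0 < μ k x) (hμ1 : ∀ k, ∑ u, μ k u = 1)
    (he : ∀ r, (e r).1 ≠ (e r).2) (a : Fin (K + 1) → ℝ) {A : Finset S} (hφA : ∀ r u, φ r u ∈ A ↔ u ∈ A) :
    dirichletForm (tensorFun μ) (ptGraphSwap μ e φ) (fun x => ∑ k, a k * bottleneckTestFun (μ k) A (x k))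
      ≤ 1 / (2 * m) * ∑ r : Fin m, (a (e r).1 - a (e r).2) ^ 2
          * ((∑ u ∈ A, μ (e r).1 u) * (∑ u ∈ Aᶜ, μ (e r).2 u)
            + (∑ u ∈ Aᶜ, μ (e r).1 u) * ∑ u ∈ A, μ (e r).2 u) := by
  refine le_trans (ptGraph_dirichletForm_swap_le hμ he _) (le_of_eq ?_)
  congr 1
  refine sum_congr rfl fun r _ => ?_
  rw [← levelDisagreement_eq μ hμ1 A (he r), Finset.mul_sum]
  refine sum_congr rfl fun x _ => ?_
  rw [graphProfileCount_sub_swap hμ1 a (hφA r) (he r) x]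
  ring

/-- The graph sampler's Dirichlet form splits: `𝓔_P(G) = t·𝓔_{GSw}(G) + (1−t)·𝓔_{Upd}(G)`. [ours] -/
theorem ptGraph_dirichletForm_split (t : ℝ) (μ : Fin (K + 1) → S → ℝ) (M : Fin (K + 1) → S → S → ℝ)
    (e : Fin m → Fin (K + 1) × Fin (K + 1)) (φ : Fin m → Equiv.Perm S) (G : (Fin (K + 1) → S) → ℝ) :
    dirichletForm (tensorFun μ) (ptGraphSampler t μ M e φ) G
      = t * dirichletForm (tensorFun μ) (ptGraphSwap μ e φ) G
        + (1 - t) * dirichletForm (tensorFun μ) (prodKernel (fun _ : Fin (K + 1) => (1 : ℝ) / (K + 1)) M) G := by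
  unfold dirichletForm
  rw [← mul_assoc, ← mul_assoc, mul_comm t, mul_comm (1 - t), mul_assoc, mul_assoc, ← mul_add]
  congr 1
  rw [Finset.mul_sum, Finset.mul_sum, ← Finset.sum_add_distrib]
  refine sum_congr rfl fun x _ => ?_
  rw [Finset.mul_sum, Finset.mul_sum, ← Finset.sum_add_distrib]
  refine sum_congr rfl fun y _ => ?_
  rw [ptGraphSampler_apply]
  ring

/-! ## §2 The profile ceiling for every graph -/

/-- **THE PROFILE CEILING ON A SWAP GRAPH (sector-preserving maps):**
`Gap(ptGraphSampler t μ M e φ) ≤ [t·(2m)⁻¹·Σ_r (a_{i_r} − a_{l_r})²·D_{i_r l_r}(A) + (1−t)·(K+1)⁻¹·Σ_k a_k²·Q_k(A,Aᶜ)]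
/ Σ_k a_k²·μ_k(A)μ_k(Aᶜ)` (`0 ≤ t ≤ 1`, `|S| ≥ 2`, edges with distinct endpoints). [ours] -/
theorem ptGraph_spectralGap_le_profile [Nontrivial S] (hμ : ∀ k x, 0 < μ k x) (hμ1 : ∀ k, ∑ u, μ k u = 1)
    (hM : ∀ k, IsRowStochastic (M k)) (hMrev : ∀ k, DetailedBalance (μ k) (M k)) (ht0 : 0 ≤ t) (ht1 : t ≤ 1)
    (he : ∀ r, (e r).1 ≠ (e r).2) (a : Fin (K + 1) → ℝ) {A : Finset S} (hφA : ∀ r u, φ r u ∈ A ↔ u ∈ A)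
    (hA : 0 < ∑ k, a k ^ 2 * ((∑ u ∈ A, μ k u) * ∑ u ∈ Aᶜ, μ k u)) :
    spectralGap (tensorFun μ) (ptGraphSampler t μ M e φ)
      ≤ (t * (1 / (2 * m) * ∑ r : Fin m, (a (e r).1 - a (e r).2) ^ 2
            * ((∑ u ∈ A, μ (e r).1 u) * (∑ u ∈ Aᶜ, μ (e r).2 u)
              + (∑ u ∈ Aᶜ, μ (e r).1 u) * ∑ u ∈ A, μ (e r).2 u))
          + (1 - t) * (1 / (K + 1) * ∑ k, a k ^ 2 * edgeMeasure (μ k) (M k) A Aᶜ))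
        / ∑ k, a k ^ 2 * ((∑ u ∈ A, μ k u) * ∑ u ∈ Aᶜ, μ k u) := by
  have hP := ptGraphSampler_isRowStochastic (M := M) (e := e) (φ := φ) hμ hM ht0 ht1
  have hDB := ptGraphSampler_detailedBalance (t := t) (M := M) (e := e) (φ := φ) hμ hMrev
  have hray := LevinPeres2017_lemma_13_7_rayleigh (tensorFun_pos hμ) (sum_tensorFun_eq_one μ hμ1) hP hDB
    (ptBare_mean_profileCount (μ := μ) hμ1 a A)
  rw [ptBare_piInner_profileCount hμ1 a A, ptGraph_dirichletForm_split,
    ptBare_dirichletForm_update_profileCount hμ1 hM hMrev a A] at hray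
  have hsw := ptGraph_dirichletForm_swap_profileCount_le (μ := μ) hμ hμ1 he a hφA
  rw [le_div_iff₀ hA]
  calc spectralGap (tensorFun μ) (ptGraphSampler t μ M e φ) * ∑ k, a k ^ 2 * ((∑ u ∈ A, μ k u) * ∑ u ∈ Aᶜ, μ k u)
      ≤ t * dirichletForm (tensorFun μ) (ptGraphSwap μ e φ) (fun x => ∑ k, a k * bottleneckTestFun (μ k) A (x k))
          + (1 - t) * (1 / (K + 1) * ∑ k, a k ^ 2 * edgeMeasure (μ k) (M k) A Aᶜ) := hray
    _ ≤ _ := by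
        have := mul_le_mul_of_nonneg_left hsw ht0
        linarith

/-! ## §3 The hot-indicator profile: the topology sets the order -/

/-- The square norm of the hot-indicator profile: `Σ_{k ≠ 0} μ_k(A)μ_k(Aᶜ) ≥ K·v`. [ours] -/
theorem hotIndicator_norm_ge (A : Finset S) {v : ℝ}
    (hv : ∀ k : Fin (K + 1), k ≠ 0 → v ≤ (∑ u ∈ A, μ k u) * ∑ u ∈ Aᶜ, μ k u) :
    (K : ℝ) * v ≤ ∑ k : Fin (K + 1), (if k = 0 then (0 : ℝ) else 1) ^ 2 * ((∑ u ∈ A, μ k u) * ∑ u ∈ Aᶜ, μ k u) := by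
  have hcount : ∑ k : Fin (K + 1), (if k = 0 then (0 : ℝ) else v) = K * v := by
    rw [Finset.sum_ite, Finset.sum_const_zero, zero_add, Finset.sum_const, nsmul_eq_mul]
    congr 1
    have : (univ.filter fun k : Fin (K + 1) => ¬k = 0) = univ.erase 0 := by ext k; simp
    rw [this, Finset.card_erase_of_mem (mem_univ _), Finset.card_univ, Fintype.card_fin]
    push_cast; ring
  rw [← hcount]
  refine sum_le_sum fun k _ => ?_
  by_cases hk : k = 0
  · rw [if_pos hk, if_pos hk]; simp
  · rw [if_neg hk, if_neg hk, one_pow, one_mul]; exact hv k hk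

/-- With the hot-indicator profile only the HOT-INCIDENT edges have a gradient, and it is one:
`Σ_r (a_{i_r} − a_{l_r})²D_r ≤ d·h`, `h` the number of edges with an endpoint at level `0` (`i_r ≠ l_r`, `D_r ≤ d`
there). [ours] -/
theorem hotIndicator_swap_le (he : ∀ r, (e r).1 ≠ (e r).2) (A : Finset S) {d : ℝ}
    (hd : ∀ r : Fin m, (e r).1 = 0 ∨ (e r).2 = 0 →
      (∑ u ∈ A, μ (e r).1 u) * (∑ u ∈ Aᶜ, μ (e r).2 u) + (∑ u ∈ Aᶜ, μ (e r).1 u) * ∑ u ∈ A, μ (e r).2 u ≤ d) :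
    ∑ r : Fin m, ((if (e r).1 = 0 then (0 : ℝ) else 1) - (if (e r).2 = 0 then (0 : ℝ) else 1)) ^ 2
        * ((∑ u ∈ A, μ (e r).1 u) * (∑ u ∈ Aᶜ, μ (e r).2 u) + (∑ u ∈ Aᶜ, μ (e r).1 u) * ∑ u ∈ A, μ (e r).2 u)
      ≤ d * ((univ.filter fun r : Fin m => (e r).1 = 0 ∨ (e r).2 = 0).card : ℝ) := by
  have hgrad : ∀ r : Fin m, ((if (e r).1 = 0 then (0 : ℝ) else 1) - (if (e r).2 = 0 then (0 : ℝ) else 1)) ^ 2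
      = if (e r).1 = 0 ∨ (e r).2 = 0 then 1 else 0 := by
    intro r
    by_cases h1 : (e r).1 = 0
    · have h2 : ¬(e r).2 = 0 := fun h2 => he r (h1.trans h2.symm)
      rw [if_pos h1, if_neg h2, if_pos (Or.inl h1)]; norm_num
    · by_cases h2 : (e r).2 = 0
      · rw [if_neg h1, if_pos h2, if_pos (Or.inr h2)]; norm_num
      · rw [if_neg h1, if_neg h2, if_neg (not_or.mpr ⟨h1, h2⟩)]; norm_num
  simp_rw [hgrad, ite_mul, one_mul, zero_mul]
  rw [← Finset.sum_filter]
  calc ∑ r ∈ univ.filter (fun r : Fin m => (e r).1 = 0 ∨ (e r).2 = 0),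
        ((∑ u ∈ A, μ (e r).1 u) * (∑ u ∈ Aᶜ, μ (e r).2 u) + (∑ u ∈ Aᶜ, μ (e r).1 u) * ∑ u ∈ A, μ (e r).2 u)
      ≤ ∑ _r ∈ univ.filter (fun r : Fin m => (e r).1 = 0 ∨ (e r).2 = 0), d :=
        sum_le_sum fun r hr => hd r (Finset.mem_filter.mp hr).2
    _ = d * ((univ.filter fun r : Fin m => (e r).1 = 0 ∨ (e r).2 = 0).card : ℝ) := by
        rw [Finset.sum_const, nsmul_eq_mul, mul_comm]

/-- **THE TOPOLOGY SETS THE ORDER:** on any swap graph with `m ≥ 1` edges (distinct endpoints), sector-preserving maps,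
sector-frozen cold replicas (`Q_k(A,Aᶜ) = 0` for `k ≥ 1`; the hot update arbitrary), `D ≤ d` on the edges touching
level `0` and `μ_k(A)μ_k(Aᶜ) ≥ v > 0` for `k ≥ 1` (`K ≥ 1`):
`Gap(ptGraphSampler t μ M e φ) ≤ t·h·d/(2·m·K·v)`, `h` = number of edges with an endpoint at the hot level. [ours] -/
theorem ptGraphFrozen_spectralGap_le [Nontrivial S] (hK : 1 ≤ K) (hm : 1 ≤ m) (hμ : ∀ k x, 0 < μ k x)
    (hμ1 : ∀ k, ∑ u, μ k u = 1) (hM : ∀ k, IsRowStochastic (M k)) (hMrev : ∀ k, DetailedBalance (μ k) (M k))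
    (ht0 : 0 ≤ t) (ht1 : t ≤ 1) (he : ∀ r, (e r).1 ≠ (e r).2) {A : Finset S} (hφA : ∀ r u, φ r u ∈ A ↔ u ∈ A)
    {d v : ℝ} (hvpos : 0 < v)
    (hd : ∀ r : Fin m, (e r).1 = 0 ∨ (e r).2 = 0 →
      (∑ u ∈ A, μ (e r).1 u) * (∑ u ∈ Aᶜ, μ (e r).2 u) + (∑ u ∈ Aᶜ, μ (e r).1 u) * ∑ u ∈ A, μ (e r).2 u ≤ d)
    (hv : ∀ k : Fin (K + 1), k ≠ 0 → v ≤ (∑ u ∈ A, μ k u) * ∑ u ∈ Aᶜ, μ k u)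
    (hfrozen : ∀ k : Fin (K + 1), k ≠ 0 → edgeMeasure (μ k) (M k) A Aᶜ = 0) :
    spectralGap (tensorFun μ) (ptGraphSampler t μ M e φ)
      ≤ t * ((univ.filter fun r : Fin m => (e r).1 = 0 ∨ (e r).2 = 0).card : ℝ) * d / (2 * m * K * v) := by
  have hKpos : (0 : ℝ) < K := Nat.cast_pos.mpr (by omega)
  have hmpos : (0 : ℝ) < m := Nat.cast_pos.mpr (by omega)
  set a : Fin (K + 1) → ℝ := fun k => if k = 0 then (0 : ℝ) else 1 with ha
  have hnorm := hotIndicator_norm_ge (μ := μ) A hv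
  have hKv : 0 < (K : ℝ) * v := mul_pos hKpos hvpos
  have hA : 0 < ∑ k : Fin (K + 1), a k ^ 2 * ((∑ u ∈ A, μ k u) * ∑ u ∈ Aᶜ, μ k u) := lt_of_lt_of_le hKv hnorm
  have hmain := ptGraph_spectralGap_le_profile (t := t) (M := M) (e := e) (φ := φ) hμ hμ1 hM hMrev ht0 ht1 he a
    hφA hA
  have hD0 : ∀ r : Fin m,
      0 ≤ (∑ u ∈ A, μ (e r).1 u) * (∑ u ∈ Aᶜ, μ (e r).2 u) + (∑ u ∈ Aᶜ, μ (e r).1 u) * ∑ u ∈ A, μ (e r).2 u :=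
    fun r => add_nonneg (mul_nonneg (sum_nonneg fun u _ => (hμ _ u).le) (sum_nonneg fun u _ => (hμ _ u).le))
      (mul_nonneg (sum_nonneg fun u _ => (hμ _ u).le) (sum_nonneg fun u _ => (hμ _ u).le))
  have hswap := hotIndicator_swap_le (μ := μ) he A hd
  set h : ℝ := ((univ.filter fun r : Fin m => (e r).1 = 0 ∨ (e r).2 = 0).card : ℝ) with hh
  -- the leak vanishes: `a_0 = 0`, `Q_k = 0` for `k ≠ 0`
  have hQ0 : ∑ k : Fin (K + 1), a k ^ 2 * edgeMeasure (μ k) (M k) A Aᶜ = 0 := by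
    refine Finset.sum_eq_zero fun k _ => ?_
    by_cases hk : k = 0
    · rw [ha]; simp only; rw [if_pos hk]; ring
    · rw [hfrozen k hk, mul_zero]
  have hdh : 0 ≤ d * h := le_trans (sum_nonneg fun r _ => mul_nonneg (sq_nonneg _) (hD0 r)) hswap
  have hnum : t * (1 / (2 * m) * ∑ r : Fin m, (a (e r).1 - a (e r).2) ^ 2
          * ((∑ u ∈ A, μ (e r).1 u) * (∑ u ∈ Aᶜ, μ (e r).2 u) + (∑ u ∈ Aᶜ, μ (e r).1 u) * ∑ u ∈ A, μ (e r).2 u))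
        + (1 - t) * (1 / (K + 1) * ∑ k : Fin (K + 1), a k ^ 2 * edgeMeasure (μ k) (M k) A Aᶜ)
      ≤ t * (1 / (2 * m) * (d * h)) := by
    rw [hQ0, mul_zero, mul_zero, add_zero]
    exact mul_le_mul_of_nonneg_left (mul_le_mul_of_nonneg_left hswap (by positivity)) ht0
  calc spectralGap (tensorFun μ) (ptGraphSampler t μ M e φ) ≤ _ := hmain
    _ ≤ t * (1 / (2 * m) * (d * h)) / ∑ k : Fin (K + 1), a k ^ 2 * ((∑ u ∈ A, μ k u) * ∑ u ∈ Aᶜ, μ k u) :=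
        div_le_div_of_nonneg_right hnum hA.le
    _ ≤ t * (1 / (2 * m) * (d * h)) / ((K : ℝ) * v) :=
        div_le_div_of_nonneg_left (by positivity) hKv hnorm
    _ = t * h * d / (2 * m * K * v) := by
        field_simp

/-- **THE STAR AT THE HOT REPLICA IS AT BEST ORDER `K`:** with the `K` edges `(0, r+1)`, sector-preserving maps and
sector-frozen cold replicas, `Gap(ptGraphSampler t μ M e φ) ≤ t·d/(2·K·v)` — `K` cold replicas share the one hot
sampler. [ours] -/
theorem ptStarFrozen_spectralGap_le [Nontrivial S] (hK : 1 ≤ K) (hμ : ∀ k x, 0 < μ k x)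
    (hμ1 : ∀ k, ∑ u, μ k u = 1) (hM : ∀ k, IsRowStochastic (M k)) (hMrev : ∀ k, DetailedBalance (μ k) (M k))
    (ht0 : 0 ≤ t) (ht1 : t ≤ 1) {φ : Fin K → Equiv.Perm S} {A : Finset S} (hφA : ∀ r u, φ r u ∈ A ↔ u ∈ A)
    {d v : ℝ} (hvpos : 0 < v)
    (hd : ∀ r : Fin K, (∑ u ∈ A, μ 0 u) * (∑ u ∈ Aᶜ, μ r.succ u) + (∑ u ∈ Aᶜ, μ 0 u) * ∑ u ∈ A, μ r.succ u ≤ d)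
    (hv : ∀ k : Fin (K + 1), k ≠ 0 → v ≤ (∑ u ∈ A, μ k u) * ∑ u ∈ Aᶜ, μ k u)
    (hfrozen : ∀ k : Fin (K + 1), k ≠ 0 → edgeMeasure (μ k) (M k) A Aᶜ = 0) :
    spectralGap (tensorFun μ) (ptGraphSampler t μ M (fun r : Fin K => ((0 : Fin (K + 1)), r.succ)) φ)
      ≤ t * d / (2 * K * v) := by
  have hKpos : (0 : ℝ) < K := Nat.cast_pos.mpr (by omega)
  have he : ∀ r : Fin K, ((fun r : Fin K => ((0 : Fin (K + 1)), r.succ)) r).1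
      ≠ ((fun r : Fin K => ((0 : Fin (K + 1)), r.succ)) r).2 := fun r => (Fin.succ_ne_zero r).symm
  have h := ptGraphFrozen_spectralGap_le (t := t) (M := M) (φ := φ) hK hK hμ hμ1 hM hMrev ht0 ht1 he hφA hvpos
    (fun r _ => hd r) hv hfrozen
  have hcard : ((univ.filter fun r : Fin K => ((fun r : Fin K => ((0 : Fin (K + 1)), r.succ)) r).1 = 0
      ∨ ((fun r : Fin K => ((0 : Fin (K + 1)), r.succ)) r).2 = 0).card : ℝ) = K := by
    have : (univ.filter fun r : Fin K => ((fun r : Fin K => ((0 : Fin (K + 1)), r.succ)) r).1 = 0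
        ∨ ((fun r : Fin K => ((0 : Fin (K + 1)), r.succ)) r).2 = 0) = univ := by
      ext r; simp
    rw [this, Finset.card_univ, Fintype.card_fin]
  rw [hcard] at h
  calc spectralGap (tensorFun μ) (ptGraphSampler t μ M (fun r : Fin K => ((0 : Fin (K + 1)), r.succ)) φ) ≤ _ := h
    _ = t * d / (2 * K * v) := by
        field_simp

/-! ## §4 The total sector count: one tunnelling replica caps every topology at order `K²` -/

/-- **THE TOTAL SECTOR COUNT IS INVISIBLE TO EVERY SWAP GRAPH:** for sector-preserving maps and edges with distinct
endpoints, `Gap(ptGraphSampler t μ M e φ) ≤ (1−t)·Σ_k Q_k(A,Aᶜ)/((K+1)·Σ_k μ_k(A)μ_k(Aᶜ))` — the ladder-averaged exit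
flow of the replicas' OWN updates (`0 ≤ t ≤ 1`, `|S| ≥ 2`, `Σ_k μ_k(A)μ_k(Aᶜ) > 0`). [ours] -/
theorem ptGraph_spectralGap_le_sectorCount [Nontrivial S] (hμ : ∀ k x, 0 < μ k x) (hμ1 : ∀ k, ∑ u, μ k u = 1)
    (hM : ∀ k, IsRowStochastic (M k)) (hMrev : ∀ k, DetailedBalance (μ k) (M k)) (ht0 : 0 ≤ t) (ht1 : t ≤ 1)
    (he : ∀ r, (e r).1 ≠ (e r).2) {A : Finset S} (hφA : ∀ r u, φ r u ∈ A ↔ u ∈ A)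
    (hA : 0 < ∑ k, (∑ u ∈ A, μ k u) * ∑ u ∈ Aᶜ, μ k u) :
    spectralGap (tensorFun μ) (ptGraphSampler t μ M e φ)
      ≤ (1 - t) * (∑ k, edgeMeasure (μ k) (M k) A Aᶜ) / ((K + 1) * ∑ k, (∑ u ∈ A, μ k u) * ∑ u ∈ Aᶜ, μ k u) := by
  have hA1 : 0 < ∑ k, (1 : ℝ) ^ 2 * ((∑ u ∈ A, μ k u) * ∑ u ∈ Aᶜ, μ k u) := by simpa using hA
  have h := ptGraph_spectralGap_le_profile (t := t) (M := M) (e := e) (φ := φ) hμ hμ1 hM hMrev ht0 ht1 he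
    (fun _ => (1 : ℝ)) hφA hA1
  simp only [sub_self, one_pow, one_mul, zero_pow two_ne_zero, zero_mul, Finset.sum_const_zero, mul_zero,
    zero_add] at h
  calc spectralGap (tensorFun μ) (ptGraphSampler t μ M e φ) ≤ _ := h
    _ = (1 - t) * (∑ k, edgeMeasure (μ k) (M k) A Aᶜ) / ((K + 1) * ∑ k, (∑ u ∈ A, μ k u) * ∑ u ∈ Aᶜ, μ k u) := by
        have hK : (0 : ℝ) < K + 1 := by positivity
        field_simp

/-- **ONE TUNNELLING REPLICA CAPS EVERY TOPOLOGY AT ORDER `K²`:** sector-frozen cold replicas (`Q_k(A,Aᶜ) = 0`, `k ≥ 1`),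
`μ_k(A)μ_k(Aᶜ) ≥ v > 0` (`k ≥ 1`), sector-preserving maps, any swap graph (`K ≥ 1`):
`Gap(ptGraphSampler t μ M e φ) ≤ (1−t)·Q_0(A,Aᶜ)/((K+1)·K·v)` — the hot replica is updated one step in `K+1` and every
fresh sector label it produces serves one cold replica. [ours] -/
theorem ptGraphFrozen_spectralGap_le_hot [Nontrivial S] (hK : 1 ≤ K) (hμ : ∀ k x, 0 < μ k x)
    (hμ1 : ∀ k, ∑ u, μ k u = 1) (hM : ∀ k, IsRowStochastic (M k)) (hMrev : ∀ k, DetailedBalance (μ k) (M k))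
    (ht0 : 0 ≤ t) (ht1 : t ≤ 1) (he : ∀ r, (e r).1 ≠ (e r).2) {A : Finset S} (hφA : ∀ r u, φ r u ∈ A ↔ u ∈ A)
    {v : ℝ} (hvpos : 0 < v) (hv : ∀ k : Fin (K + 1), k ≠ 0 → v ≤ (∑ u ∈ A, μ k u) * ∑ u ∈ Aᶜ, μ k u)
    (hfrozen : ∀ k : Fin (K + 1), k ≠ 0 → edgeMeasure (μ k) (M k) A Aᶜ = 0) :
    spectralGap (tensorFun μ) (ptGraphSampler t μ M e φ)
      ≤ (1 - t) * edgeMeasure (μ 0) (M 0) A Aᶜ / ((K + 1) * (K * v)) := by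
  have hKpos : (0 : ℝ) < K := Nat.cast_pos.mpr (by omega)
  -- the sector variances: `Σ_k μ_k(A)μ_k(Aᶜ) ≥ K·v`
  have hnorm := hotIndicator_norm_ge (μ := μ) A hv
  have hVge : (K : ℝ) * v ≤ ∑ k : Fin (K + 1), (∑ u ∈ A, μ k u) * ∑ u ∈ Aᶜ, μ k u := by
    refine hnorm.trans (sum_le_sum fun k _ => ?_)
    have h0 : 0 ≤ (∑ u ∈ A, μ k u) * ∑ u ∈ Aᶜ, μ k u :=
      mul_nonneg (sum_nonneg fun u _ => (hμ _ u).le) (sum_nonneg fun u _ => (hμ _ u).le)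
    split_ifs <;> nlinarith
  have hA : 0 < ∑ k, (∑ u ∈ A, μ k u) * ∑ u ∈ Aᶜ, μ k u := lt_of_lt_of_le (mul_pos hKpos hvpos) hVge
  have h := ptGraph_spectralGap_le_sectorCount (t := t) (M := M) (e := e) (φ := φ) hμ hμ1 hM hMrev ht0 ht1 he hφA hA
  -- only the hot replica's exit flow survives
  have hQ : ∑ k : Fin (K + 1), edgeMeasure (μ k) (M k) A Aᶜ = edgeMeasure (μ 0) (M 0) A Aᶜ := by
    rw [Finset.sum_eq_single (0 : Fin (K + 1)) (fun k _ hk => hfrozen k hk) (fun h => absurd (mem_univ _) h)]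
  rw [hQ] at h
  have hQ0 : 0 ≤ (1 - t) * edgeMeasure (μ 0) (M 0) A Aᶜ := by
    refine mul_nonneg (by linarith) ?_
    unfold edgeMeasure
    exact sum_nonneg fun x _ => sum_nonneg fun y _ => mul_nonneg (hμ 0 x).le ((hM 0).1 x y)
  calc spectralGap (tensorFun μ) (ptGraphSampler t μ M e φ) ≤ _ := h
    _ ≤ (1 - t) * edgeMeasure (μ 0) (M 0) A Aᶜ / ((K + 1) * (K * v)) :=
        div_le_div_of_nonneg_left hQ0 (by positivity) (mul_le_mul_of_nonneg_left hVge (by positivity))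

end Summit.Ventures.LatticeQCDFlow.Scaling

end
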